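import Mathlib
import Summits.Ventures.PercRepro2.CutVertexDefs
import Summits.Ventures.PercRepro2.Induced

/-!
# Two-root cuts: the root pair as a separator
(blind cell PercRepro2, night-1 g32; proofs/NIGHT1-G32.md §6, the root-shield identity)

`RootCut.IsRootCut ends a₁ a₂ VR VS ER ES`: the roots `a₁, a₂` separate the vertex sets `VR` and
`VS` (edges partitioned into `ER ⊆ within (VR ∪ {a₁, a₂})` and `ES ⊆ within (VS ∪ {a₁, a₂})`).
* product law `prob_sideEvent_inter_eq_mul` (verbatim from the cut-vertex case: it only uses the
  disjointness of the edge sides);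
* the path lemma ON `Q_R` (`conn_iff_restrict_of_not_conn`): when the roots are not joined inside
  `R`, connectivity on `VS ∪ {a₁, a₂}` is decided by the `S`-edges — via the ω-dependent collapse
  `rootCollapse` sending each `R`-vertex to the root it is joined to inside `R`;
* **`Q` factorises**: `avoidAll ends a₂ {a₁} = sideEvent ER Q ∩ sideEvent ES Q` and
  `P(Q) = P_R(Q_R) · P_S(Q_S)` (`avoidAll_eq_inter_sideEvent`, `prob_avoidAll_eq_mul`).
Standard axioms.
-/

namespace Summit.Ventures.PercRepro2.RootCut

open CutV

variable {V : Type*} {E : Type*}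

/-- The roots `a₁, a₂` separate `VR` from `VS`, with the edge partition `ER` / `ES`. -/
structure IsRootCut (ends : E → Sym2 V) (a₁ a₂ : V) (VR VS : Set V) (ER ES : Set E) : Prop where
  /-- The two sides are disjoint. -/
  disj : Disjoint VR VS
  /-- The roots are on neither side. -/
  a₁_notR : a₁ ∉ VR
  a₂_notR : a₂ ∉ VR
  a₁_notS : a₁ ∉ VS
  a₂_notS : a₂ ∉ VS
  /-- `R`-edges lie inside `VR ∪ {a₁, a₂}`. -/
  ER_sub : ER ⊆ within ends (VR ∪ {a₁, a₂})
  /-- `S`-edges lie inside `VS ∪ {a₁, a₂}`. -/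
  ES_sub : ES ⊆ within ends (VS ∪ {a₁, a₂})
  /-- Every edge is on one of the two sides. -/
  cover : ∀ e, e ∈ ER ∨ e ∈ ES
  /-- No edge is on both sides. -/
  Edisj : Disjoint ER ES

variable {ends : E → Sym2 V} {a₁ a₂ : V} {VR VS : Set V} {ER ES : Set E}

/-- The two sides may be exchanged. -/
lemma IsRootCut.symm (h : IsRootCut ends a₁ a₂ VR VS ER ES) :
    IsRootCut ends a₁ a₂ VS VR ES ER :=
  ⟨h.disj.symm, h.a₁_notS, h.a₂_notS, h.a₁_notR, h.a₂_notR, h.ES_sub, h.ER_sub,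
    fun e => (h.cover e).symm, h.Edisj.symm⟩

/-- Membership in a side with the roots. -/
lemma mem_side_iff {S : Set V} {v : V} : v ∈ S ∪ {a₁, a₂} ↔ v ∈ S ∨ v = a₁ ∨ v = a₂ := by
  simp only [Set.mem_union, Set.mem_insert_iff, Set.mem_singleton_iff]

/-- Both endpoints of an `R`-edge lie on the `R`-side. -/
lemma IsRootCut.ends_mem_of_mem_ER (h : IsRootCut ends a₁ a₂ VR VS ER ES) {e : E} (he : e ∈ ER)
    {a b : V} (hab : ends e = s(a, b)) : a ∈ VR ∪ {a₁, a₂} ∧ b ∈ VR ∪ {a₁, a₂} := by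
  obtain ⟨a', ha', b', hb', h'⟩ := h.ER_sub he
  rw [hab] at h'
  rcases Sym2.eq_iff.mp h' with ⟨rfl, rfl⟩ | ⟨rfl, rfl⟩
  · exact ⟨ha', hb'⟩
  · exact ⟨hb', ha'⟩

/-- An `R`-side vertex that is also on the `S`-side is a root. -/
lemma IsRootCut.eq_root_of_mem_both (h : IsRootCut ends a₁ a₂ VR VS ER ES) {v : V}
    (hR : v ∈ VR ∪ {a₁, a₂}) (hS : v ∈ VS ∪ {a₁, a₂}) : v = a₁ ∨ v = a₂ := by
  rcases mem_side_iff.1 hR with hv | hv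
  · rcases mem_side_iff.1 hS with hv' | hv'
    · exact absurd hv' (Set.disjoint_left.mp h.disj hv)
    · exact hv'
  · exact hv

section ProductLaw

variable [Fintype E] [DecidableEq E] {R : Type*} [CommRing R]

/-- **Product law**: events read on the two sides of a root cut are independent. -/
theorem prob_sideEvent_inter_eq_mul (p : E → R) [DecidablePred (· ∈ ER)] [DecidablePred (· ∈ ES)]
    (h : IsRootCut ends a₁ a₂ VR VS ER ES) (A B : Set (Config E)) :
    prob p (sideEvent ER A ∩ sideEvent ES B) = prob p (sideEvent ER A) * prob p (sideEvent ES B) :=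
  prob_inter_eq_mul_of_dependsOn p h.Edisj (dependsOn_sideEvent ER A) (dependsOn_sideEvent ES B)

end ProductLaw

section PathLemma

variable [DecidablePred (· ∈ ER)] [DecidablePred (· ∈ ES)]

open Classical in
/-- The collapse onto the `S`-side: `S`-side vertices are fixed; an `R`-vertex goes to `a₂` if it is
joined to `a₂` inside `R`, else to `a₁`. -/
noncomputable def rootCollapse (ends : E → Sym2 V) (ER : Set E) [DecidablePred (· ∈ ER)]
    (ω : Config E) (VS : Set V) (a₁ a₂ : V) (v : V) : V :=
  if v ∈ VS ∪ {a₁, a₂} then v else if Conn ends (restrict ER ω) v a₂ then a₂ else a₁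

/-- `rootCollapse` fixes the `S`-side. -/
lemma rootCollapse_of_mem {ω : Config E} {v : V} (hv : v ∈ VS ∪ {a₁, a₂}) :
    rootCollapse ends ER ω VS a₁ a₂ v = v := by
  simp only [rootCollapse, if_pos hv]

/-- An `R`-vertex joined to `a₂` inside `R` collapses to `a₂`. -/
lemma rootCollapse_of_conn₂ {ω : Config E} {v : V} (hv : v ∉ VS ∪ {a₁, a₂})
    (hc : Conn ends (restrict ER ω) v a₂) : rootCollapse ends ER ω VS a₁ a₂ v = a₂ := by
  simp only [rootCollapse, if_neg hv, if_pos hc]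

/-- An `R`-vertex not joined to `a₂` inside `R` collapses to `a₁`. -/
lemma rootCollapse_of_not_conn₂ {ω : Config E} {v : V} (hv : v ∉ VS ∪ {a₁, a₂})
    (hc : ¬ Conn ends (restrict ER ω) v a₂) : rootCollapse ends ER ω VS a₁ a₂ v = a₁ := by
  simp only [rootCollapse, if_neg hv, if_neg hc]

omit [DecidablePred (· ∈ ES)] in
open Classical in
/-- The value of the collapse at an `R`-side vertex joined inside `R` to a vertex `r`, when the
roots are not joined inside `R`: it is `a₂` iff `r ↔ a₂` inside `R`. -/
lemma rootCollapse_eq_of_conn (h : IsRootCut ends a₁ a₂ VR VS ER ES) {ω : Config E}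
    (hQ : ¬ Conn ends (restrict ER ω) a₁ a₂) {v r : V} (hv : v ∈ VR ∪ {a₁, a₂})
    (hvr : Conn ends (restrict ER ω) v r) :
    rootCollapse ends ER ω VS a₁ a₂ v = if Conn ends (restrict ER ω) r a₂ then a₂ else a₁ := by
  by_cases hvS : v ∈ VS ∪ {a₁, a₂}
  · rw [rootCollapse_of_mem hvS]
    rcases h.eq_root_of_mem_both hv hvS with rfl | rfl
    · rw [if_neg]
      intro hc
      exact hQ (conn_trans hvr hc)
    · rw [if_pos (conn_trans (conn_symm hvr) (conn_refl _ _ _))]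
  · by_cases hc : Conn ends (restrict ER ω) r a₂
    · rw [rootCollapse_of_conn₂ hvS (conn_trans hvr hc), if_pos hc]
    · rw [rootCollapse_of_not_conn₂ hvS (fun hc' => hc (conn_trans (conn_symm hvr) hc')), if_neg hc]

/-- One open edge of `ω` collapses to an open `S`-edge or to a fixed point. -/
lemma adj_rootCollapse (h : IsRootCut ends a₁ a₂ VR VS ER ES) {ω : Config E}
    (hQ : ¬ Conn ends (restrict ER ω) a₁ a₂) {a b : V} (hab : (openGraph ends ω).Adj a b) :
    Conn ends (restrict ES ω) (rootCollapse ends ER ω VS a₁ a₂ a)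
      (rootCollapse ends ER ω VS a₁ a₂ b) := by
  rw [openGraph_adj] at hab
  obtain ⟨_, e, he, hends⟩ := hab
  rcases h.cover e with hR | hS
  · obtain ⟨ha, hb⟩ := h.ends_mem_of_mem_ER hR hends
    have hconn : Conn ends (restrict ER ω) a b := by
      refine conn_of_openAdj ⟨e, ?_, hends⟩
      rw [restrict_apply_of_mem hR]
      exact he
    rw [rootCollapse_eq_of_conn h hQ ha hconn, rootCollapse_eq_of_conn h hQ hb (conn_refl _ _ _)]
    exact conn_refl _ _ _
  · obtain ⟨ha, hb⟩ := h.symm.ends_mem_of_mem_ER hS hends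
    rw [rootCollapse_of_mem ha, rootCollapse_of_mem hb]
    refine conn_of_openAdj ⟨e, ?_, hends⟩
    rw [restrict_apply_of_mem hS]
    exact he

/-- **Collapse lemma**: when the roots are not joined inside `R`, a connection in `ω` collapses to
a connection inside the `S`-side. -/
theorem conn_rootCollapse (h : IsRootCut ends a₁ a₂ VR VS ER ES) {ω : Config E}
    (hQ : ¬ Conn ends (restrict ER ω) a₁ a₂) {u v : V} (huv : Conn ends ω u v) :
    Conn ends (restrict ES ω) (rootCollapse ends ER ω VS a₁ a₂ u)
      (rootCollapse ends ER ω VS a₁ a₂ v) := by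
  rw [Conn, SimpleGraph.reachable_iff_reflTransGen] at huv
  induction huv with
  | refl => exact conn_refl _ _ _
  | tail _ hab ih => exact conn_trans ih (adj_rootCollapse h hQ hab)

/-- **Path lemma on `Q_R`**: for `u, v ∈ VS ∪ {a₁, a₂}`, when the roots are not joined inside `R`,
`u ↔ v` in `ω` iff `u ↔ v` using the `S`-edges alone. -/
theorem conn_iff_restrict_of_not_conn (h : IsRootCut ends a₁ a₂ VR VS ER ES) {ω : Config E}
    (hQ : ¬ Conn ends (restrict ER ω) a₁ a₂) {u v : V} (hu : u ∈ VS ∪ {a₁, a₂})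
    (hv : v ∈ VS ∪ {a₁, a₂}) : Conn ends ω u v ↔ Conn ends (restrict ES ω) u v := by
  constructor
  · intro huv
    have key := conn_rootCollapse h hQ huv
    rwa [rootCollapse_of_mem hu, rootCollapse_of_mem hv] at key
  · exact conn_mono (restrict_le ES ω)

/-- **`Q` factorises**: the roots are disconnected iff they are disconnected inside `R` and inside
`S`. -/
theorem not_conn_iff (h : IsRootCut ends a₁ a₂ VR VS ER ES) {ω : Config E} :
    ¬ Conn ends ω a₂ a₁ ↔
      ¬ Conn ends (restrict ER ω) a₂ a₁ ∧ ¬ Conn ends (restrict ES ω) a₂ a₁ := by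
  constructor
  · intro hn
    exact ⟨fun hc => hn (conn_mono (restrict_le ER ω) hc),
      fun hc => hn (conn_mono (restrict_le ES ω) hc)⟩
  · rintro ⟨hR, hS⟩ hc
    have hQ : ¬ Conn ends (restrict ER ω) a₁ a₂ := fun hc' => hR (conn_symm hc')
    exact hS ((conn_iff_restrict_of_not_conn h hQ (Or.inr (Or.inr rfl)) (Or.inr (Or.inl rfl))).1 hc)

/-- `Q = Q_R ∩ Q_S` as events. -/
theorem avoidAll_eq_inter_sideEvent (h : IsRootCut ends a₁ a₂ VR VS ER ES) :
    avoidAll ends a₂ {a₁} =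
      sideEvent ER (avoidAll ends a₂ {a₁}) ∩ sideEvent ES (avoidAll ends a₂ {a₁}) := by
  ext ω
  simp only [avoidAll, Set.mem_setOf_eq, Finset.mem_singleton, forall_eq, Set.mem_inter_iff,
    mem_sideEvent]
  exact not_conn_iff h

/-- **`P(Q) = P_R(Q_R) · P_S(Q_S)`.** -/
theorem prob_avoidAll_eq_mul [Fintype E] [DecidableEq E] {R : Type*} [CommRing R] (p : E → R)
    (h : IsRootCut ends a₁ a₂ VR VS ER ES) :
    prob p (avoidAll ends a₂ {a₁}) =
      prob p (sideEvent ER (avoidAll ends a₂ {a₁})) * prob p (sideEvent ES (avoidAll ends a₂ {a₁})) := by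
  have key := prob_sideEvent_inter_eq_mul p h (avoidAll ends a₂ {a₁}) (avoidAll ends a₂ {a₁})
  rw [← avoidAll_eq_inter_sideEvent h] at key
  exact key

end PathLemma

end Summit.Ventures.PercRepro2.RootCut
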